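import Mathlib
import Summits.SmoothPoincare4.SmoothPoincare4.Theorems.SoloBlindGenericState
import Summits.SmoothPoincare4.SmoothPoincare4.Theorems.SoloBlindCofactor

/-!
# Ghost reciprocity: the margin numerators of the three ghost directions (solo-blind s8)

Companion to `SoloBlindGhost` (paper `cs-gompf-classes.md` §4e, solo seat `solo-SmoothPoincare4-blind`).
For a direction `G = A x² + B x + C` (cusp values `P = C`, `Q = A + B + C`, margin numerator
`E(G) = AQ - AP - PQ`) with cofactor `K` and unit multiples `M₁ ≡ x(x-1)K`, `M₂ ≡ x²(x-1)K`, `M₃ ≡ x(x-1)²K (mod f_t)`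
(coefficients from `cofM₁_eq`, `cofM₂_eq`, `cofM₃_eq`), the margin numerators of the ghost directions are

  `E(M₁) = -A · N_t(G)`,  `E(M₂) = -P · N_t(G)`,  `E(M₃) = -Q · N_t(G)`      (`ghostE_M₁/₂/₃`)

and their norms at the parent fibre are `N_t(M₂) = N_t(M₃) = N_t(G)²` (`norm_cofM₂`, `norm_cofM₃`; `M₁` in `SoloBlindGhost`).
RECIPROCITY: for the child `J' = J_G` of a state of norm `d` (so `d' = |N_t(G)|/d²`) the integer margin parameter
`e' := E/(d·d')·d = E(M_i/d)/d'` of the ghost direction `M_i/d ∈ Λ_{J'}` is `∓A`, `∓P`, `∓Q` respectively, while its smallest cusp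
coordinate is `|e| = |E(G)|/d`: the pair (margin parameter, small coordinate) of the parent direction is SWAPPED along the
ghost directions — the mechanism of the "margins do not decay along the canonical directions" observation of §4d R26(5) and of
the generation-3 conservation law of §4e.  Pure algebra (`ring`).
-/

namespace Summit.SmoothPoincare4.SmoothPoincare4.Theorems

section GhostReciprocity
variable {R : Type*} [CommRing R]

/-- Margin numerator `E = lead·(value at 1) - lead·(value at 0) - (value at 0)(value at 1)` of `a x² + b x + c`. -/
def cuspE (a b c : R) : R := a * (a + b + c) - a * c - c * (a + b + c)

/-- `E(M₁) = -A · N_t(G)`. -/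
theorem ghostE_M₁ (A B C t : R) :
    cuspE (-(A ^ 2) - A * B + A * C + B * C + C ^ 2)
        (t * A ^ 2 + t * A * B + A * B - 2 * A * C + B ^ 2 - B * C - C ^ 2)
        (-(t * A ^ 2) - t * A * B - t * A * C + 2 * A ^ 2 + A * C - B ^ 2 - B * C)
      = -A * normForm A B C t := by
  unfold cuspE normForm normE₁ normE₀; ring

/-- `E(M₂) = -P · N_t(G)` (`P = C`). -/
theorem ghostE_M₂ (A B C t : R) :
    cuspE (t * A * C + t * B * C + t * C ^ 2 + A * B - 2 * A * C + B ^ 2 - B * C - C ^ 2)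
        (-(2 * t * A * C) - t * B * C - t * C ^ 2 + A ^ 2 - A * B + 2 * A * C - B ^ 2 + C ^ 2)
        (-(A ^ 2) - A * B + A * C + B * C + C ^ 2)
      = -C * normForm A B C t := by
  unfold cuspE normForm normE₁ normE₀; ring

/-- `E(M₃) = -Q · N_t(G)` (`Q = A + B + C`). -/
theorem ghostE_M₃ (A B C t : R) :
    cuspE (t * A * C + t * B * C + t * C ^ 2 + A ^ 2 + 2 * A * B - 3 * A * C + B ^ 2 - 2 * B * C - 2 * C ^ 2)
        (-(t * A ^ 2) - t * A * B - 2 * t * A * C - t * B * C - t * C ^ 2 + A ^ 2 - 2 * A * B + 4 * A * C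
            - 2 * B ^ 2 + B * C + 2 * C ^ 2)
        (t * A ^ 2 + t * A * B + t * A * C - 3 * A ^ 2 - A * B + B ^ 2 + 2 * B * C + C ^ 2)
      = -(A + B + C) * normForm A B C t := by
  unfold cuspE normForm normE₁ normE₀; ring

/-- `N_t(M₂) = N_t(G)²`. -/
theorem norm_cofM₂ (A B C t : R) :
    normForm (t * A * C + t * B * C + t * C ^ 2 + A * B - 2 * A * C + B ^ 2 - B * C - C ^ 2)
        (-(2 * t * A * C) - t * B * C - t * C ^ 2 + A ^ 2 - A * B + 2 * A * C - B ^ 2 + C ^ 2)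
        (-(A ^ 2) - A * B + A * C + B * C + C ^ 2) t
      = normForm A B C t ^ 2 := by
  unfold normForm normE₁ normE₀; ring

/-- `N_t(M₃) = N_t(G)²`. -/
theorem norm_cofM₃ (A B C t : R) :
    normForm (t * A * C + t * B * C + t * C ^ 2 + A ^ 2 + 2 * A * B - 3 * A * C + B ^ 2 - 2 * B * C - 2 * C ^ 2)
        (-(t * A ^ 2) - t * A * B - 2 * t * A * C - t * B * C - t * C ^ 2 + A ^ 2 - 2 * A * B + 4 * A * C
            - 2 * B ^ 2 + B * C + 2 * C ^ 2)
        (t * A ^ 2 + t * A * B + t * A * C - 3 * A ^ 2 - A * B + B ^ 2 + 2 * B * C + C ^ 2) t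
      = normForm A B C t ^ 2 := by
  unfold normForm normE₁ normE₀; ring

/-- `E` of a scaled triple scales quadratically (so `E(M_i/d) = E(M_i)/d²`; with `N_t(G) = ± d² d'` this gives the
integer margin parameter `E(M_i/d)/d' = ∓(A, P, Q)_i`). -/
theorem cuspE_smul (k a b c : R) : cuspE (k * a) (k * b) (k * c) = k ^ 2 * cuspE a b c := by
  unfold cuspE; ring

end GhostReciprocity

end Summit.SmoothPoincare4.SmoothPoincare4.Theorems
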